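import Summits.SmoothPoincare4.SmoothPoincare4.Theorems.SoloInformedPuncturedEmbedding
import Literature.Barriers.SmoothPoincare4.GluckTwistsDissolve
import Literature.Topology.FourManifolds.Rasmussen
import Summits.SmoothPoincare4.SmoothPoincare4.Statement
import HarnessLib
import HarnessLib.Audit.Tags

/-!
# The `s`-invariant slicing programme sits on the embedding conjunct of the path

Solo informed SmoothPoincare4, session 20.  The landed path is
`SPC4 ⇐ EMB ∧ SS4 ∧ (Γ₄ = 0)` (`SoloInformedEmbeddingRoute.lean`), and its first conjunct has the
boundary-free form `PuncturedPoincareSphereEmbedding` (`SoloInformedPuncturedEmbedding.lean`: every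
punctured homotopy 4-sphere is a standard open subset of `S⁴`; implied by SPC4).  The tree's barrier
catalogue registers the Freedman–Gompf–Morrison–Walker / Manolescu–Piccirillo programme as the OPEN
statement `Literature.Barriers.SmoothPoincare4.FGMWRasmussenStrategy` ("some knot slice in a homotopy
4-ball has `s ≠ 0`") and its negation as MMSW 2023, Question 9.11 (knots),
`Literature.Barriers.SmoothPoincare4.MMSW2023Question911Knot`, with the Gluck-twist case settled by
MMSW Cor. 1.13 and the dissolution lemma of §9.3 (`mmsw2023_sZero_of_dissolvesInCP2`).

This file records, sorry-free and GIVEN only Rasmussen's theorem `s(slice) = 0` as the tree's named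
fact `Literature.Topology.FourManifolds.eq_zero_of_isSmoothlySlice` (Rasmussen 2010, Thm. 1), where that
programme sits relative to the path:

* `isSmoothlySlice_of_isSliceDiscIn_of_puncturedEmbeds` — PER SPHERE: if `M` punctured embeds in `S⁴`
  (for every `p`, `M ∖ {p}` is diffeomorphic to an open subset of the round `S⁴`; `PuncturedPoincareSphereEmbedding`
  is literally "every closed smooth `M ≃ₕ S⁴` has this property"),
  every knot bounding a smooth proper disc in `M ∖ B̊⁴` is slice (the proof of session 19, localised to one
  manifold: shrink, puncture off the datum by a Sard-type lemma, transport, Palais + neatening — all proved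
  in the imported files).  Hence `rasmussen_eq_zero_of_isSliceDiscIn_of_puncturedEmbeds`: such knots have
  `s = 0`.  Compare the tree's cited §9.3 fact `mmsw2023_sZero_of_dissolvesInCP2` (hypothesis: `M`
  dissolves in `ℂℙ²`; conclusion the same): here the hypothesis is an EMBEDDING property of `M` minus a
  point and the statement is PROVED.
* `not_puncturedEmbedsInSphere_of_isSliceDiscIn` — contrapositive, the exoticness certificate the
  programme is after, placed: a knot with `s ≠ 0` slice in `M ∖ B̊⁴` certifies that NOT every `M ∖ {p}` is a
  standard open subset of `S⁴` (by homogeneity — not used here — then no `M ∖ {p}` is), i.e. `M` violates the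
  embedding conjunct (not merely SPC4).
* `mmsw2023Question911Knot_of_puncturedPoincareSphereEmbedding`, `mmsw2023Question911Knot_of_smoothPoincare4`
  — the punctured-embedding property, and a fortiori SPC4, answer MMSW Question 9.11 (knots) in the
  affirmative; `not_puncturedPoincareSphereEmbedding_of_fgmwRasmussenStrategy` — a success of the
  `s`-strategy refutes the embedding conjunct.  (The docstring of `MMSW2023Question911Knot` notes that SPC4
  would answer it; that remark is now a theorem, with SPC4 weakened to the first conjunct of the path.)

Sources: M. Freedman, R. Gompf, S. Morrison, K. Walker, Quantum Topol. 1 (2010), §1–2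
[FreedmanGompfMorrisonWalker2010]; C. Manolescu, M. Marengon, S. Sarkar, M. Willis, Duke Math. J. (2023),
Cor. 1.13, §9.3 and Question 9.11 [ManolescuMarengonSarkarWillis2023]; C. Manolescu, L. Piccirillo,
J. Lond. Math. Soc. 108 (2023), §1 [ManolescuPiccirillo2023]; J. Rasmussen, Invent. Math. 182 (2010), Thm. 1
[Rasmussen2010]; J. Hass, R. Kirby, J. Open Math. Problems 1 (2025), §4 Question 4.2 [HassKirby2025];
C. Manolescu, *From knots to four-manifolds*, arXiv:2601.05425 (2026), §7.2 p. 24 ("it is not known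
whether the same holds in all other homotopy 4-spheres").  No new axioms, no `sorry`; nothing here decides
`PuncturedPoincareSphereEmbedding`, `FGMWRasmussenStrategy` or `MMSW2023Question911Knot`.
-/

noncomputable section

open scoped Manifold ContDiff Topology
open Set Function ContinuousMap MeasureTheory

namespace Summit.SmoothPoincare4.SmoothPoincare4.Theorems

open Literature.Topology.FourManifolds Literature.Geometry.Manifold Literature.Barriers.SmoothPoincare4

/-! ### Per sphere: punctured embedding ⇒ homotopy-ball-slice knots are slice -/

/-- **If `M` punctured embeds in `S⁴`, every knot bounding a smooth proper disc in `M ∖ B̊⁴` is slice.**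
The session-19 argument localised to one manifold: (1) shrink the slice-disc datum
(`isSliceDiscIn_shrink`); (2) choose a puncture `p = e y`, `‖y‖ > 2`, off both images — the set of bad
`y` is Lebesgue-null (`exists_norm_gt_apply_notMem_image`); (3) transport the datum along
`M ∖ {p} ≅ U ⊆ S⁴` (`isSliceDiscIn_transport_opens`); (4) Palais' ball-complement theorem in `S⁴` and
neatening (`Knot.palais_ballComplement_sphere_four_holds`, `IsSliceDiscIn.exists_isProperDisc`,
`Knot.isSmoothlySlice_of_isProperDisc_holds`, all proved in `HomotopyBallSliceProofs.lean`).  No homotopy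
hypothesis on `M` is needed. [cite: FreedmanGompfMorrisonWalker2010, §2 p. 6 and Fact 2.1] -/
theorem isSmoothlySlice_of_isSliceDiscIn_of_puncturedEmbeds {M : Type} [TopologicalSpace M]
    [T2Space M] [ChartedSpace (EuclideanSpace ℝ (Fin 4)) M] [IsManifold (𝓡 4) ∞ M]
    (hM : ∀ p : M, ∃ U : TopologicalSpace.Opens (Metric.sphere (0 : EuclideanSpace ℝ (Fin (4 + 1))) 1),
      Nonempty ((⟨({p}ᶜ : Set M), isOpen_compl_singleton⟩ : TopologicalSpace.Opens M) ≃ₘ⟮𝓡 4, 𝓡 4⟯ U)) (K : Knot) {e : EuclideanSpace ℝ (Fin 4) → M}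
    {f : EuclideanSpace ℝ (Fin 2) → M} (hef : K.IsSliceDiscIn M e f) : K.IsSmoothlySlice := by
  -- (1) shrink
  have hef' := isSliceDiscIn_shrink hef
  -- (2) general position: a puncture off both images
  obtain ⟨y, hy, hyC⟩ := exists_norm_gt_apply_notMem_image hef.isSmoothEmbedding hef.contMDiff
    (Metric.ball (0 : EuclideanSpace ℝ (Fin 2)) (√2))
  have h22 : √2 < (2 : ℝ) := by
    rw [Real.sqrt_lt' (by norm_num)]; norm_num
  set V : TopologicalSpace.Opens M := ⟨({e y}ᶜ : Set M), isOpen_compl_singleton⟩ with hV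
  have heV : ∀ z, (e ∘ OpenPartialHomeomorph.univBall (0 : EuclideanSpace ℝ (Fin 4)) (√2)) z ∈ V := by
    intro z hz
    have hz' : OpenPartialHomeomorph.univBall (0 : EuclideanSpace ℝ (Fin 4)) (√2) z = y :=
      hef.isSmoothEmbedding.isEmbedding.injective (mem_singleton_iff.mp hz)
    have := norm_univBall_sqrt_two_lt z
    rw [hz'] at this
    linarith
  have hfV : ∀ x, (f ∘ OpenPartialHomeomorph.univBall (0 : EuclideanSpace ℝ (Fin 2)) (√2)) x ∈ V := by
    intro x hx
    refine hyC ⟨OpenPartialHomeomorph.univBall (0 : EuclideanSpace ℝ (Fin 2)) (√2) x, ?_,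
      (mem_singleton_iff.mp hx).symm ▸ rfl⟩
    rw [mem_ball_zero_iff]
    exact norm_univBall_sqrt_two_lt x
  -- (3) transport along `M ∖ {p} ≅ U ⊆ S⁴`
  obtain ⟨U, ⟨ψ⟩⟩ := hM (e y)
  obtain ⟨e', f', h'⟩ := isSliceDiscIn_transport_opens hef' V heV hfV ψ
  -- (4) Palais + neatening
  obtain ⟨U', c, hc₁, hc₂⟩ := Knot.palais_ballComplement_sphere_four_holds e' h'.isSmoothEmbedding
  obtain ⟨g, hg⟩ := h'.exists_isProperDisc c hc₁ hc₂
  exact Knot.isSmoothlySlice_of_isProperDisc_holds K g hg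

/-- **Knots slice in a sphere that punctured embeds in `S⁴` have `s = 0`**, GIVEN Rasmussen's theorem
`s(slice) = 0` (tree fact `Literature.Topology.FourManifolds.eq_zero_of_isSmoothlySlice`).  Compare the
cited §9.3 fact `Literature.Barriers.SmoothPoincare4.mmsw2023_sZero_of_dissolvesInCP2` (same conclusion
from "`M` dissolves in `ℂℙ²`"); the present statement is proved.
[cite: Rasmussen2010, Thm. 1] [cite: ManolescuMarengonSarkarWillis2023, §9.3] -/
theorem rasmussen_eq_zero_of_isSliceDiscIn_of_puncturedEmbeds (hs0 : eq_zero_of_isSmoothlySlice)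
    {M : Type} [TopologicalSpace M] [T2Space M] [ChartedSpace (EuclideanSpace ℝ (Fin 4)) M]
    [IsManifold (𝓡 4) ∞ M] (hM : ∀ p : M, ∃ U : TopologicalSpace.Opens (Metric.sphere (0 : EuclideanSpace ℝ (Fin (4 + 1))) 1),
      Nonempty ((⟨({p}ᶜ : Set M), isOpen_compl_singleton⟩ : TopologicalSpace.Opens M) ≃ₘ⟮𝓡 4, 𝓡 4⟯ U)) (K : Knot)
    {e : EuclideanSpace ℝ (Fin 4) → M} {f : EuclideanSpace ℝ (Fin 2) → M}
    (hef : K.IsSliceDiscIn M e f) {s : ℤ} (hs : K.HasRasmussenInvariant s) : s = 0 :=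
  hs0 hs (isSmoothlySlice_of_isSliceDiscIn_of_puncturedEmbeds hM K hef)

/-- **The programme's certificate, placed on the embedding conjunct.**  GIVEN Rasmussen's theorem, a knot
with `s ≠ 0` bounding a smooth proper disc in `M ∖ B̊⁴` certifies that `M` does NOT punctured-embed in
`S⁴` (it is false that every `M ∖ {p}` is a standard open subset of `S⁴`).  For `M ≃ₕ S⁴` closed smooth this
refutes `PuncturedPoincareSphereEmbedding`, the boundary-free form of the first conjunct of the path
`SPC4 ⇐ EMB ∧ SS4 ∧ (Γ₄ = 0)`. [cite: FreedmanGompfMorrisonWalker2010, §1] [cite: Rasmussen2010, Thm. 1] -/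
theorem not_puncturedEmbedsInSphere_of_isSliceDiscIn (hs0 : eq_zero_of_isSmoothlySlice)
    {M : Type} [TopologicalSpace M] [T2Space M] [ChartedSpace (EuclideanSpace ℝ (Fin 4)) M]
    [IsManifold (𝓡 4) ∞ M] (K : Knot) {e : EuclideanSpace ℝ (Fin 4) → M}
    {f : EuclideanSpace ℝ (Fin 2) → M} (hef : K.IsSliceDiscIn M e f) {s : ℤ}
    (hs : K.HasRasmussenInvariant s) (hs0' : s ≠ 0) :
    ¬ ∀ p : M, ∃ U : TopologicalSpace.Opens (Metric.sphere (0 : EuclideanSpace ℝ (Fin (4 + 1))) 1),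
      Nonempty ((⟨({p}ᶜ : Set M), isOpen_compl_singleton⟩ : TopologicalSpace.Opens M) ≃ₘ⟮𝓡 4, 𝓡 4⟯ U) :=
  fun hM => hs0' (rasmussen_eq_zero_of_isSliceDiscIn_of_puncturedEmbeds hs0 hM K hef hs)

/-! ### Globally: MMSW Question 9.11 (knots) and the FGMW strategy versus the path -/

/-- **The punctured-embedding property answers MMSW 2023, Question 9.11 (knots), affirmatively**, GIVEN
Rasmussen's theorem: if every punctured homotopy 4-sphere is a standard open subset of `S⁴`, then every
knot slice in a homotopy 4-ball has `s = 0`.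
[cite: ManolescuMarengonSarkarWillis2023, Question 9.11] [cite: Rasmussen2010, Thm. 1] -/
theorem mmsw2023Question911Knot_of_puncturedPoincareSphereEmbedding (hs0 : eq_zero_of_isSmoothlySlice)
    (hE : PuncturedPoincareSphereEmbedding) : MMSW2023Question911Knot := by
  intro K hK s hs
  obtain ⟨M, _, _, _, _, _, _, hM, e, f, hef⟩ := hK
  exact rasmussen_eq_zero_of_isSliceDiscIn_of_puncturedEmbeds hs0 (hE M hM) K hef hs

/-- **SPC4 answers MMSW 2023, Question 9.11 (knots), affirmatively**, GIVEN Rasmussen's theorem (the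
remark in the docstring of `MMSW2023Question911Knot`, as a theorem: SPC4 ⇒ punctured embedding ⇒
homotopy-ball-slice knots are slice ⇒ `s = 0`).
[cite: ManolescuMarengonSarkarWillis2023, Question 9.11] [cite: Rasmussen2010, Thm. 1] -/
theorem mmsw2023Question911Knot_of_smoothPoincare4 (hs0 : eq_zero_of_isSmoothlySlice)
    (h : SmoothPoincare4) : MMSW2023Question911Knot :=
  mmsw2023Question911Knot_of_puncturedPoincareSphereEmbedding hs0
    (puncturedPoincareSphereEmbedding_of_smoothPoincare4 h)

/-- **A success of the FGMW `s`-strategy refutes the embedding conjunct of the path** (not merely SPC4),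
GIVEN Rasmussen's theorem: `FGMWRasmussenStrategy → ¬ PuncturedPoincareSphereEmbedding`.  In the path
`SPC4 ⇐ EMB ∧ SS4 ∧ (Γ₄ = 0)` the whole Khovanov-theoretic slicing programme (FGMW 2010; MP 2023; the
2025 census; Manolescu 2026 §7.2) is therefore an attack on the conjunct EMB, and says nothing about the
Schoenflies conjunct or `Γ₄`.
[cite: FreedmanGompfMorrisonWalker2010, §1] [cite: ManolescuPiccirillo2023, §1] -/
theorem not_puncturedPoincareSphereEmbedding_of_fgmwRasmussenStrategy
    (hs0 : eq_zero_of_isSmoothlySlice) (h : FGMWRasmussenStrategy) :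
    ¬ PuncturedPoincareSphereEmbedding := by
  intro hE
  obtain ⟨K, ⟨M, _, _, _, _, _, _, hM, e, f, hef⟩, s, hs, hs0'⟩ := h
  exact not_puncturedEmbedsInSphere_of_isSliceDiscIn hs0 K hef hs hs0' (hE M hM)

end Summit.SmoothPoincare4.SmoothPoincare4.Theorems

end
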